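import Summits.KontsevichZagierPeriods.KontsevichZagierPeriods.Theses.SiegelTamagawa
import Summits.KontsevichZagierPeriods.KontsevichZagierPeriods.Theorems.InverseLandauTateLiftingWheelBodyToAffineChart

/-!
# `WheelBodyToAffineChart` (stmt-KontsevichZagierPeriods-4418, route SiegelTamagawa) — proof

For the Kirchhoff (spanning-tree) polynomial `F` of `K₄ = W₃` (16 cubic monomials in the six edge
variables), the body representation `[{x > 0, F(x) < 1} ⊆ ℝ⁶, 6]` and the affine-chart representation
`[{y > 0} ⊆ ℝ⁵, F(y, 1)⁻²]` are equivalent in the Kontsevich–Zagier calculus: for any representations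
`r`, `r'` with these domains and these integrands on them, `KZ.Equivalent r r'`. This is verbatim
`InverseLandau.tateLifting_wheelBodyToAffineChart`
(Theorems/InverseLandauTateLiftingWheelBodyToAffineChart.lean; stub `stub_wheelBodyToAffineChart` of
line `Sketch` of the crux `TateLifting`, lead c10): one change of variables along the cone chart
`(y, t) ↦ (t y, t)` (Jacobian `t⁵`), one Newton–Leibniz move in `t` with primitive `t⁶` and upper
edge `F(y, 1)^{-1/3}`, and null-set bookkeeping between the open and the closed band.
-/

namespace Summit.KontsevichZagierPeriods.SiegelTamagawa

/-- **`WheelBodyToAffineChart`** (route SiegelTamagawa, stmt-KontsevichZagierPeriods-4418): six times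
the body `{x > 0, F(x) < 1}` of the Kirchhoff polynomial of `K₄` is KZ-equivalent to
`[{y > 0}, F(y, 1)⁻²]`. Proof: `InverseLandau.tateLifting_wheelBodyToAffineChart`.
[cite: KontsevichZagier2001, §1.2] -/
theorem wheelBodyToAffineChart_proof :
    Summit.KontsevichZagierPeriods.KontsevichZagierPeriods.Theses.SiegelTamagawa.WheelBodyToAffineChart :=
  Summit.KontsevichZagierPeriods.InverseLandau.tateLifting_wheelBodyToAffineChart

end Summit.KontsevichZagierPeriods.SiegelTamagawa
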